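import Summits.QuantumFields.BalabanUV.T4Continuum.Support.NE7PcTDivergenceSup
import Summits.QuantumFields.BalabanUV.T4Continuum.Support.NE7FlatHkOrthogonal
import Summits.QuantumFields.BalabanUV.T4Continuum.Support.NE7FlatHkCurlLetter
import Summits.QuantumFields.BalabanUV.T4Continuum.Support.NE7TorusBoxDictionary
import Summits.QuantumFields.BalabanUV.T4Continuum.Support.NE7EnergySliceLocalForm
import Summits.QuantumFields.BalabanUV.T4Continuum.Support.NE3FrameFreeSliceUnique
import Summits.QuantumFields.BalabanUV.T4Continuum.Support.NE3CurvedProjectedLandau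
import Literature.MathematicalPhysics.QuantumFieldTheory.Balaban1983to89.B5G115SupBound
import HarnessLib

/-!
# NE7EnergySliceSupFlatSite — THE FLAT SUP LETTER IN THE T4 (`Site`) LANGUAGE, GENERAL DIVERGENCE: a periodic direction `Y` with VANISHING ITERATED BLOCK AVERAGE
# `Q̄₁Y := QbarIter L (k+1) 1 Y = 0` satisfies `‖Y(y,κ)‖ ≤ M·(K·sup‖curl₁ Y‖ + K′·sup_x‖div₁ Y x − c(blk_M x)‖)` for EVERY coarse `c` (`M = L^{k+1}`; `K, K′` depend on `d`, `card n`
# only); in particular THE CURVED SUP LETTER (L) HOLDS AT THE FLAT BACKGROUND in the exact shape `hLet` of `NE7SliceStepContraction.split_error_sized`: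
# `Y ∈ 𝒯_E(1) = energyBlockLandauW L N (k+1) 1 ⟹ ‖Y(y,κ)‖ ≤ K·L^{k+1}·sup_{μ≠ν}‖curlAt 1 Y‖`

Cell `pub-balaban`, rung (B)+1 sub-cell t4, lineage `b2b-balaban-t4-ne7-p1`, generation 101 (CRUX PROVER NE7 #1 = OWNER of BINDER row NE7).  Memo
`t4/b2b-balaban-t4-ne7-p1-g101/ROAD-G101.md` §1: the base case AND the engine of the local bootstrap for THE CURVED SUP LETTER (L) (memo ROAD-G100 §4): the bootstrap
applies the flat letter to a cut-off, axially gauged, flatly re-projected copy of a curved slice element, whose divergence is block-constant only UP TO AN ERROR — hence the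
general-divergence form proved here.
THE TORUS LINES (§1, over gen 99's `NE7EnergySliceSupFlatOfPcT` and the tree's IR1 `NE7PcTDivergenceSup.pcT_gradOpH_sup`, IR2 `NE7SharpConstrainedGradientRow.sharp_sup_rows_cubic`,
Landau letter `NE7LandauLinearSup.exists_sup_const`): `x ∈ ker Q_k` with `∂ᴴx = Q′*c + s`, `‖s‖_∞ ≤ D`: `x = x_B + ∂μ₀`, `‖x_B‖_∞ ≤ C·B`; `∂ᴴx_B = P∂ᴴx_B` so `‖∂ᴴx_B‖ ≤ C_P·C·B`;
`Δμ₀ = ∂ᴴx − ∂ᴴx_B = (s − ∂ᴴx_B) + Q′*c` is a sharp constrained problem with source of size `D + C_P·C·B`, so `‖∂μ₀‖_∞ ≤ C_Q(D + C_P·C·B)`; sum: `‖x‖_∞ ≤ C(1 + C_Q C_P)·B + C_Q·D`.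
THE DICTIONARY (§2–§3, over gen 69–74's bridges `NE7FlatAverageBridge.linQ_pullback_eq`, `NE7TorusBoxDictionary.curlAt_flat_entry_torus`, row NE3's `QbarIter_flat`, `iterate_Qcoarse_apply`,
`covDiv_flatCfg_eq_flatDiv`): entry by entry `y_e(t,κ) := Y(rep t, κ)_{ii′}` on the fine torus `Tor (fine M (N,…,N))`: `Q_k y_e = M⁻¹·(Q̄₁Y)_{ii′} = 0`, `F^{η}(y_e) = M·(curl₁Y)_{ii′}`,
`∂ᴴ y_e(t) = −M·(div₁ Y (rep t))_{ii′}`, `rep (blockOf t) = blk_M (rep t)`; and at the flat background the nested covariant block-constant extension is the plain one,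
`nestedExt L (k+1) 1 g = g ∘ blk_{L^{k+1}}`, so for `Y ∈ 𝒯_E(1)` the local form `NE7EnergySliceLocalForm.covDiv_eq_nestedExt_of_mem` makes `div₁ Y` EXACTLY `M`-block-constant (`D = 0`).
WHAT ([folklore]; 0 def, 0 sorry; dimension `d + 1`; `L ≥ 1`, every `k`, every `N ≥ 1`).
§1 `energySlice_sup_general` (torus, η-units).  §2 `rep_blockOf_eq_blk`, `toT_rep_sub_e`, `divS_entry`, `qvOp_entry_eq_zero_of_QbarIter`, `Fs_entry_le`.  §3 `blk_blk`, `hol_flatCfg`, `nestedExt_flat`.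
§4 **`sup_flat_of_QbarIter`** (Site, general divergence).  §5 **`energySlice_sup_flat_site`** — (L) AT `W = 1`: `∃ K > 0`, ∀ `L ≥ 1`, `k`, `N ≥ 1`, ∀ `Y ∈ energyBlockLandauW L N (k+1) flatCfg`,
∀ `B` with `‖curlAt 1 Y z μ ν‖ ≤ B` (`μ ≠ ν`): `‖Y y κ‖ ≤ K·L^{k+1}·B`.
HONEST FRAMING (page 1): `U = 1`, linear; constants existential through GAN24's letters (functions of `d`, `card n`); THE CURVED LETTER (L) IS NOT PROVED HERE (this is its `W = 1` case and
its engine); NOT (S1), NOT NE7; spine 0∕9; finite T⁴ rung (B)+1 — NOT infinite volume, NOT mass gap, NOT BetaPertH, NOT Clay.  [B5] (1.26), [B8] (1.38) are TEXT LOCATIONS; nothing printed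
is asserted.  Continuum YM on T⁴ ⇐ BetaPertH ∧ nine spine estimates (0/9 proved); BetaPertH ⇐ (D1) ∧ (D4) ∧ CAP+tail; G-an2-4 gates asym, D1 and NE2/3/4.
-/

set_option autoImplicit false

open scoped BigOperators Matrix ComplexConjugate Matrix.Norms.L2Operator
open Finset

namespace Summit.QuantumFields.BalabanUV.T4Continuum.NE7EnergySliceSupFlatSite

open Literature.MathematicalPhysics.QuantumFieldTheory.Balaban1983to89
open B7Prop1Explicit (Site e e_apply Letter hol stepHol treeWord)
open T4AveragingDeficitWall (IsUnitaryCfg IsSkewDir SmallField Ad curlAt)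
open T4AveragingDeficitWallBoundary (IsPeriodicCfg periodBox)
open AveragingDeficitPeriodicCounting (IsPeriodicDir)
open AveragingDeficitMultiLevelPrep (cavgIter LevelSmall tower levelSmall_of_pow)
open B5Prop11Plancherel (Tor fine unitVec)
open B5Action121 (LapS sdiff Fs GradOp GradOp_mulVec GradOp_conjTranspose_mulVec divS_apply Fs_self sdiff_mulVec)
open B5Block118 (QsOp QvOp bpt)
open B5Blocks16 (blockOf bpt_val)
open B5Value126 (lambda0 QsOp_lambda0 PcT)
open B5G115SupBound (exists_eq_bpt_blockOf)
open B6LowerBound2153Torus (toT rep toT_rep)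
open Summit.QuantumFields.BalabanUV.Beta.GAN24.SoftMinimiserOneStepSup (blkInj blkInj_mulVec)
open BlockAveragePushDirSplit (flat)
open MinimalActionWitness (flatCfg isPeriodicCfg_flatCfg)
open NE3TangentFlatPush (flatCfg_eq_flat)
open NE3FlatHessianCurl (isUnitaryCfg_flatCfg smallField_flatCfg_zero)
open NE3CoercivityScaling (flatDiv)
open NE3CovariantWeitzenbock (covDiv)
open NE3FrameFreeSliceUnique (covDiv_flatCfg_eq_flatDiv)
open NE3TangentCovariantTower (QbarIter QbarIter_flat)
open NE3SmoothRightInverseFlat (iterate_Qcoarse_apply)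
open NE3CurvedProjectedLandau (tower_eq_pow_mul)
open SmoothRefineBlocks (blk res)
open NE7CornerSpikeTopDictionary (natCast_tower_eq_pow_mul)
open NE7FlatAverageBridge (linQ_pullback_eq)
open NE7FlatHkRightInverse (linQ_apply_entry)
open NE7FlatHkOrthogonal (Fs_eq_mul_Fs_one)
open NE7FlatHkCurlLetter (opNorm_le_card_mul)
open NE7TorusBoxDictionary (curlAt_flat_entry_torus toT_add_e' apply_rep_toT')
open NE7LandauLinearSup (exists_sup_const)
open NE7SharpConstrainedGradientRow (sharp_sup_rows_cubic)
open NE7EnergySliceSupFlatOfPcT (landau_split div_grad div_landau_self)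
open NE7PcTDivergenceSup (pcT_gradOpH_sup)
open NE7NestedCovariantExtension (covExt nestedExt nestedExt_succ)
open NE7MeanZeroGaugeSliceW (energyBlockLandauW)
open NE7EnergySliceLocalForm (covDiv_eq_nestedExt_of_mem)
open Literature.Computability.QuantumComplexity.SolovayKitaev (norm_apply_le_norm)

noncomputable section

variable {d : ℕ} {n : Type*} [Fintype n] [DecidableEq n]

/-! ## §1 The torus letter with a general divergence -/

omit [Fintype n] [DecidableEq n] in
/-- **THE FLAT SUP LETTER WITH A GENERAL DIVERGENCE** (η-units, cubic tori, every spacing `n ≥ 1`): `∃ K K′ > 0` (functions of `d`) such that for every `x ∈ ker Q_k` whose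
divergence is within `D` of a block-constant field (`‖(∂ᴴx − Q′*c)(y)‖ ≤ D` for some coarse `c`) and every bound `B` of its plaquette field, `‖x i‖ ≤ K·B + K′·D` for every bond `i`.
(`D = 0` is the tree's `NE7PcTDivergenceSup.energySlice_sup_flat`.) [folklore] -/
theorem energySlice_sup_general (d : ℕ) :
    ∃ K : ℝ, 0 < K ∧ ∃ K' : ℝ, 0 < K' ∧ ∀ (n N₀ : ℕ) [NeZero n] [NeZero N₀], 1 ≤ n →
      ∀ (x : Tor (fine n (fun _ : Fin (d + 1) => N₀)) × Fin (d + 1) → ℂ), QvOp n (fun _ : Fin (d + 1) => N₀) *ᵥ x = 0 →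
        ∀ (c : Tor (fun _ : Fin (d + 1) => N₀) → ℂ) (D : ℝ),
          (∀ y, ‖((GradOp (fine n (fun _ : Fin (d + 1) => N₀)) (n : ℂ))ᴴ *ᵥ x) y - (blkInj n (fun _ : Fin (d + 1) => N₀) *ᵥ c) y‖ ≤ D) →
        ∀ B : ℝ, (∀ (μ ν : Fin (d + 1)) (t : Tor (fine n (fun _ : Fin (d + 1) => N₀))),
            ‖Fs (fine n (fun _ : Fin (d + 1) => N₀)) (n : ℂ) x μ ν t‖ ≤ B) →
          ∀ i, ‖x i‖ ≤ K * B + K' * D := by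
  obtain ⟨C, hC, hB⟩ := exists_sup_const (d := d)
  obtain ⟨C_Q, hC_Q, hQ⟩ := sharp_sup_rows_cubic d
  obtain ⟨C_P, hC_P, hP⟩ := pcT_gradOpH_sup d
  refine ⟨C * (1 + C_Q * C_P), by positivity, C_Q, hC_Q, fun n N₀ _ _ hn x hQv c D hD B hFs i => ?_⟩
  have hB0 : 0 ≤ B := (norm_nonneg _).trans (hFs 0 0 0)
  have hD0 : 0 ≤ D := (norm_nonneg _).trans (hD 0)
  have hCB : 0 ≤ C * B := by positivity
  -- (1) the Landau representative `x_B` is bounded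
  have h1 := hB n (fun _ : Fin (d + 1) => N₀) x hQv B hFs
  -- (2) its divergence is `P` of itself, hence bounded by IR1
  have h2 : ∀ y, ‖((GradOp (fine n (fun _ : Fin (d + 1) => N₀)) (n : ℂ))ᴴ *ᵥ
      (x - GradOp (fine n (fun _ : Fin (d + 1) => N₀)) (n : ℂ) *ᵥ lambda0 n (fun _ : Fin (d + 1) => N₀) (n : ℂ)
        ((GradOp (fine n (fun _ : Fin (d + 1) => N₀)) (n : ℂ))ᴴ *ᵥ x))) y‖ ≤ C_P * (C * B) := by
    intro y
    rw [div_landau_self n (fun _ : Fin (d + 1) => N₀) x]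
    exact hP n N₀ hn _ _ h1 y
  -- (3) the corrector solves a sharp constrained problem with source `(∂ᴴx − Q′*c) − ∂ᴴx_B`
  have hsb : ∀ y, ‖(((GradOp (fine n (fun _ : Fin (d + 1) => N₀)) (n : ℂ))ᴴ *ᵥ x) y - (blkInj n (fun _ : Fin (d + 1) => N₀) *ᵥ c) y)
      - ((GradOp (fine n (fun _ : Fin (d + 1) => N₀)) (n : ℂ))ᴴ *ᵥ
        (x - GradOp (fine n (fun _ : Fin (d + 1) => N₀)) (n : ℂ) *ᵥ lambda0 n (fun _ : Fin (d + 1) => N₀) (n : ℂ)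
          ((GradOp (fine n (fun _ : Fin (d + 1) => N₀)) (n : ℂ))ᴴ *ᵥ x))) y‖ ≤ D + C_P * (C * B) :=
    fun y => (norm_sub_le _ _).trans (add_le_add (hD y) (h2 y))
  have hc : (n : ℂ) ≠ 0 := by exact_mod_cast NeZero.ne n
  have hμQ : QsOp n (fun _ : Fin (d + 1) => N₀) *ᵥ lambda0 n (fun _ : Fin (d + 1) => N₀) (n : ℂ)
      ((GradOp (fine n (fun _ : Fin (d + 1) => N₀)) (n : ℂ))ᴴ *ᵥ x) = 0 := QsOp_lambda0 n _ (n : ℂ) hc _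
  have hμL : LapS (fine n (fun _ : Fin (d + 1) => N₀)) (n : ℂ) *ᵥ lambda0 n (fun _ : Fin (d + 1) => N₀) (n : ℂ)
      ((GradOp (fine n (fun _ : Fin (d + 1) => N₀)) (n : ℂ))ᴴ *ᵥ x)
      = (fun y => (((GradOp (fine n (fun _ : Fin (d + 1) => N₀)) (n : ℂ))ᴴ *ᵥ x) y - (blkInj n (fun _ : Fin (d + 1) => N₀) *ᵥ c) y)
          - ((GradOp (fine n (fun _ : Fin (d + 1) => N₀)) (n : ℂ))ᴴ *ᵥ
            (x - GradOp (fine n (fun _ : Fin (d + 1) => N₀)) (n : ℂ) *ᵥ lambda0 n (fun _ : Fin (d + 1) => N₀) (n : ℂ)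
              ((GradOp (fine n (fun _ : Fin (d + 1) => N₀)) (n : ℂ))ᴴ *ᵥ x))) y)
        + blkInj n (fun _ : Fin (d + 1) => N₀) *ᵥ c := by
    rw [Matrix.mulVec_sub, div_grad]
    funext y
    simp only [Pi.add_apply, Pi.sub_apply]
    ring
  have h3 := (hQ n N₀ hn _ _ c _ hsb hμQ hμL).2.2
  -- sum
  obtain ⟨t, ν⟩ := i
  have hsplit := congrFun (landau_split n (fun _ : Fin (d + 1) => N₀) x) (t, ν)
  rw [Pi.add_apply, GradOp_mulVec] at hsplit
  rw [hsplit]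
  refine (norm_add_le _ _).trans ?_
  have e : C * (1 + C_Q * C_P) * B + C_Q * D = C * B + C_Q * (D + C_P * (C * B)) := by ring
  rw [e]
  exact add_le_add (h1 _) (h3 ν t)

/-! ## §2 The dictionary: one entry of a periodic T4 direction on lit-balaban's fine torus -/

section Dictionary

variable (n₀ : ℕ) [NeZero n₀] (N : ℕ) [NeZero N]

omit [Fintype n] [DecidableEq n] in
/-- `rep (blockOf t) = blk_{n₀} (rep t)`: the block of a fine torus point, read in `ℤ^{d+1}`, is the integer quotient of its representative. [folklore] -/
theorem rep_blockOf_eq_blk (t : Tor (fine n₀ (fun _ : Fin (d + 1) => N))) :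
    rep (fun _ : Fin (d + 1) => N) (blockOf n₀ (fun _ : Fin (d + 1) => N) t) = blk n₀ (rep (fine n₀ (fun _ : Fin (d + 1) => N)) t) := by
  obtain ⟨r, hr⟩ := exists_eq_bpt_blockOf n₀ (fun _ : Fin (d + 1) => N) t
  funext ν
  have hn : 0 < n₀ := Nat.pos_of_ne_zero (NeZero.ne n₀)
  have hv : (t ν).val / n₀ = (blockOf n₀ (fun _ : Fin (d + 1) => N) t ν).val := by
    conv_lhs => rw [hr]
    rw [bpt_val, Nat.mul_add_div hn, Nat.div_eq_of_lt (r ν).isLt, add_zero]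
  simp only [rep, blk]
  rw [← hv, Int.natCast_div]

omit [Fintype n] [DecidableEq n] in
/-- `toT (rep t − e_μ) = t − u_μ`. [folklore] -/
theorem toT_rep_sub_e (t : Tor (fine n₀ (fun _ : Fin (d + 1) => N))) (μ : Fin (d + 1)) :
    toT (fine n₀ (fun _ : Fin (d + 1) => N)) (rep (fine n₀ (fun _ : Fin (d + 1) => N)) t - e μ)
      = t - unitVec (fine n₀ (fun _ : Fin (d + 1) => N)) μ := by
  rw [eq_sub_iff_add_eq, ← toT_add_e', sub_add_cancel, toT_rep]

omit [Fintype n] [DecidableEq n] in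
/-- **THE η-DIVERGENCE OF AN ENTRY IS `−n₀·` THE UNIT-LATTICE DIVERGENCE OF THE DIRECTION**: for an `(n₀N)`-periodic `Y` and the entry field `y_e(t,κ) = Y(rep t, κ)_{ii′}`,
`(∂ᴴ y_e)(t) = −n₀·(flatDiv Y (rep t))_{ii′}`. [folklore] -/
theorem divS_entry {Y : Site (d + 1) → Fin (d + 1) → Matrix n n ℂ} (hYP : IsPeriodicDir Y ((n₀ * N : ℕ) : ℤ)) (i i' : n)
    (t : Tor (fine n₀ (fun _ : Fin (d + 1) => N))) :
    ((GradOp (fine n₀ (fun _ : Fin (d + 1) => N)) (n₀ : ℂ))ᴴ *ᵥ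
        fun p : Tor (fine n₀ (fun _ : Fin (d + 1) => N)) × Fin (d + 1) => Y (rep (fine n₀ (fun _ : Fin (d + 1) => N)) p.1) p.2 i i') t
      = -(n₀ : ℂ) * flatDiv Y (rep (fine n₀ (fun _ : Fin (d + 1) => N)) t) i i' := by
  have hper : ∀ μ : Fin (d + 1), Y (rep (fine n₀ (fun _ : Fin (d + 1) => N)) (t - unitVec (fine n₀ (fun _ : Fin (d + 1) => N)) μ)) μ
      = Y (rep (fine n₀ (fun _ : Fin (d + 1) => N)) t - e μ) μ := fun μ => by
    rw [← toT_rep_sub_e n₀ N t μ, apply_rep_toT' (P := n₀ * N) hYP]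
  rw [GradOp_conjTranspose_mulVec, divS_apply, flatDiv, Matrix.sum_apply, Finset.mul_sum]
  refine Finset.sum_congr rfl fun μ _ => ?_
  dsimp only
  rw [Complex.conj_natCast, hper μ, Matrix.sub_apply]
  ring

/-- **THE STRAIGHT AVERAGE OF AN ENTRY IS `n₀⁻¹·` THE ITERATED FLAT BLOCK AVERAGE OF THE DIRECTION**: `n₀·(Q_k y_e)(t,κ) = (QbarIter L (k+1) 1 Y)(rep t, κ)_{ii′}` (`n₀ = L^{k+1}`,
`Y` `(n₀N)`-periodic). [folklore] -/
theorem qvOp_entry_eq_QbarIter {L : ℕ} (hL : 1 ≤ L) (k : ℕ) [NeZero (L ^ (k + 1))]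
    {Y : Site (d + 1) → Fin (d + 1) → Matrix n n ℂ} (hYP : IsPeriodicDir Y ((L ^ (k + 1) * N : ℕ) : ℤ)) (i i' : n)
    (t : Tor (fun _ : Fin (d + 1) => N)) (κ : Fin (d + 1)) :
    ((L ^ (k + 1) : ℕ) : ℂ) * (QvOp (L ^ (k + 1)) (fun _ : Fin (d + 1) => N) *ᵥ
        fun p : Tor (fine (L ^ (k + 1)) (fun _ : Fin (d + 1) => N)) × Fin (d + 1) =>
          Y (rep (fine (L ^ (k + 1)) (fun _ : Fin (d + 1) => N)) p.1) p.2 i i') (t, κ)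
      = QbarIter L (k + 1) (flat (d := d + 1) (n := n)) Y (rep (fun _ : Fin (d + 1) => N) t) κ i i' := by
  have hpull : (fun (x : Site (d + 1)) (μ : Fin (d + 1)) => Y x μ i i')
      = fun (x : Site (d + 1)) (μ : Fin (d + 1)) =>
          (fun p : Tor (fine (L ^ (k + 1)) (fun _ : Fin (d + 1) => N)) × Fin (d + 1) =>
            Y (rep (fine (L ^ (k + 1)) (fun _ : Fin (d + 1) => N)) p.1) p.2 i i') (toT (fine (L ^ (k + 1)) (fun _ : Fin (d + 1) => N)) x, μ) := by
    funext x μ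
    exact (apply_rep_toT' (P := L ^ (k + 1) * N) hYP x μ ▸ rfl)
  have hlin := linQ_pullback_eq (L ^ (k + 1)) (fun _ : Fin (d + 1) => N)
    (fun p : Tor (fine (L ^ (k + 1)) (fun _ : Fin (d + 1) => N)) × Fin (d + 1) => Y (rep (fine (L ^ (k + 1)) (fun _ : Fin (d + 1) => N)) p.1) p.2 i i') t κ
  rw [← hpull] at hlin
  rw [QbarIter_flat hL (k + 1) Y, iterate_Qcoarse_apply, linQ_apply_entry, ← hlin]

/-- Hence a direction with VANISHING iterated flat block average has a `Q_k`-TANGENT entry field. [folklore] -/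
theorem qvOp_entry_eq_zero_of_QbarIter {L : ℕ} (hL : 1 ≤ L) (k : ℕ) [NeZero (L ^ (k + 1))]
    {Y : Site (d + 1) → Fin (d + 1) → Matrix n n ℂ} (hYP : IsPeriodicDir Y ((L ^ (k + 1) * N : ℕ) : ℤ))
    (hYQ : QbarIter L (k + 1) (flat (d := d + 1) (n := n)) Y = 0) (i i' : n) :
    QvOp (L ^ (k + 1)) (fun _ : Fin (d + 1) => N) *ᵥ
        (fun p : Tor (fine (L ^ (k + 1)) (fun _ : Fin (d + 1) => N)) × Fin (d + 1) =>
          Y (rep (fine (L ^ (k + 1)) (fun _ : Fin (d + 1) => N)) p.1) p.2 i i') = 0 := by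
  have hnz : ((L ^ (k + 1) : ℕ) : ℂ) ≠ 0 := by exact_mod_cast NeZero.ne (L ^ (k + 1))
  funext p
  obtain ⟨t, κ⟩ := p
  have h := qvOp_entry_eq_QbarIter N hL k hYP i i' t κ
  rw [hYQ] at h
  simp only [Pi.zero_apply, Matrix.zero_apply, mul_eq_zero, hnz, false_or] at h
  rw [h, Pi.zero_apply]

/-- **THE η-PLAQUETTE FIELD OF AN ENTRY IS `n₀·` THE FLAT CURL ENTRY**, hence bounded by `n₀·B` when `‖curlAt 1 Y z μ ν‖ ≤ B` off the diagonal (`B ≥ 0`). [folklore] -/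
theorem Fs_entry_le {Y : Site (d + 1) → Fin (d + 1) → Matrix n n ℂ} (hYP : IsPeriodicDir Y ((n₀ * N : ℕ) : ℤ)) (i i' : n)
    {B : ℝ} (hB0 : 0 ≤ B) (hB : ∀ (z : Site (d + 1)) (μ ν : Fin (d + 1)), μ ≠ ν → ‖curlAt (flat (d := d + 1) (n := n)) Y z μ ν‖ ≤ B)
    (μ ν : Fin (d + 1)) (t : Tor (fine n₀ (fun _ : Fin (d + 1) => N))) :
    ‖Fs (fine n₀ (fun _ : Fin (d + 1) => N)) (n₀ : ℂ)
        (fun p : Tor (fine n₀ (fun _ : Fin (d + 1) => N)) × Fin (d + 1) => Y (rep (fine n₀ (fun _ : Fin (d + 1) => N)) p.1) p.2 i i') μ ν t‖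
      ≤ (n₀ : ℝ) * B := by
  by_cases hμν : μ = ν
  · subst hμν; rw [Fs_self, norm_zero]; positivity
  have hcurl := curlAt_flat_entry_torus (P := n₀ * N) hYP (rep (fine n₀ (fun _ : Fin (d + 1) => N)) t) μ ν i i'
  rw [toT_rep] at hcurl
  rw [Fs_eq_mul_Fs_one _ (n₀ : ℂ), norm_mul, Complex.norm_natCast]
  refine mul_le_mul_of_nonneg_left ?_ (Nat.cast_nonneg _)
  have h : Fs (fine n₀ (fun _ : Fin (d + 1) => N)) 1
      (fun p : Tor (fine n₀ (fun _ : Fin (d + 1) => N)) × Fin (d + 1) => Y (rep (fine n₀ (fun _ : Fin (d + 1) => N)) p.1) p.2 i i') μ ν t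
      = curlAt (flat (d := d + 1) (n := n)) Y (rep (fine n₀ (fun _ : Fin (d + 1) => N)) t) μ ν i i' := hcurl.symm
  rw [h]
  exact (norm_apply_le_norm _ i i').trans (hB _ μ ν hμν)

end Dictionary

/-! ## §3 The nested extension at the flat background is the plain block-constant extension -/

omit [Fintype n] [DecidableEq n] in
/-- `blk_L (blk_{L^j} x)`… in the order used by `nestedExt`: `blk_{L^j} (blk_L x) = blk_{L^{j+1}} x`. [folklore] -/
theorem blk_blk (L j : ℕ) (x : Site d) : blk (L ^ j) (blk L x) = blk (L ^ (j + 1)) x := by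
  funext i
  simp only [blk]
  push_cast
  rw [Int.ediv_ediv_of_nonneg (by positivity : (0 : ℤ) ≤ (L : ℤ)), pow_succ']

/-- the transport of the flat configuration along any word is trivial. [folklore] -/
theorem hol_flatCfg (y : Site d) (w : List (Letter d)) : hol (flatCfg (d := d) (n := n)) y w = 1 :=
  SmoothRefineBlocks.hol_eq_one_of_steps _ _ _ fun s _ => by
    unfold stepHol
    split <;> simp [flatCfg]

/-- **AT `W = 1` THE NESTED COVARIANT BLOCK-CONSTANT EXTENSION IS `g ∘ blk_{L^j}`.** [folklore] -/
theorem nestedExt_flat (L : ℕ) : ∀ (j : ℕ) (g : Site d → Matrix n n ℂ) (x : Site d),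
    nestedExt L j (flatCfg (d := d) (n := n)) g x = g (blk (L ^ j) x)
  | 0, g, x => by
      have h1 : blk 1 x = x := by funext i; simp [blk]  -- `Beta.CompositeCorrectorLocality.blk_one`, not imported here
      rw [pow_zero, h1]; rfl
  | j + 1, g, x => by
      rw [nestedExt_succ, NE3TangentFlatPush.cavg_flatCfg L]
      unfold covExt
      rw [nestedExt_flat L j g, blk_blk, hol_flatCfg, inv_one, NE3CoercivityScalingPrep.Ad_one]

/-! ## §4 The flat sup letter in the `Site` language, general divergence -/

/-- **THE FLAT SUP LETTER, `Site` LANGUAGE, GENERAL DIVERGENCE**: `∃ K K′ > 0` (functions of `d`, `card n`) such that for all `L ≥ 1`, `k`, `N ≥ 1`, every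
`(L^{k+1}N)`-periodic direction `Y` with `QbarIter L (k+1) 1 Y = 0`, every `B ≥ 0` bounding `‖curlAt 1 Y z μ ν‖` off the diagonal, and every coarse `c` with
`‖flatDiv Y x − c (blk_{L^{k+1}} x)‖ ≤ D` for all `x`: `‖Y y κ‖ ≤ L^{k+1}·(K·B + K′·D)`. [folklore] -/
theorem sup_flat_of_QbarIter [Nonempty n] :
    ∃ K : ℝ, 0 < K ∧ ∃ K' : ℝ, 0 < K' ∧ ∀ (L : ℕ), 1 ≤ L → ∀ (k N : ℕ) [NeZero N]
      (Y : Site (d + 1) → Fin (d + 1) → Matrix n n ℂ), IsPeriodicDir Y ((L ^ (k + 1) * N : ℕ) : ℤ) →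
      QbarIter L (k + 1) (flat (d := d + 1) (n := n)) Y = 0 →
      ∀ (B : ℝ), 0 ≤ B → (∀ (z : Site (d + 1)) (μ ν : Fin (d + 1)), μ ≠ ν → ‖curlAt (flat (d := d + 1) (n := n)) Y z μ ν‖ ≤ B) →
      ∀ (c : Site (d + 1) → Matrix n n ℂ) (D : ℝ), (∀ x, ‖flatDiv Y x - c (blk (L ^ (k + 1)) x)‖ ≤ D) →
      ∀ (y : Site (d + 1)) (κ : Fin (d + 1)), ‖Y y κ‖ ≤ (L : ℝ) ^ (k + 1) * (K * B + K' * D) := by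
  obtain ⟨K₀, hK₀, K₀', hK₀', h⟩ := energySlice_sup_general d
  have hcard1 : (1 : ℝ) ≤ Fintype.card n := by exact_mod_cast Fintype.card_pos
  refine ⟨Fintype.card n * K₀, by positivity, Fintype.card n * K₀', by positivity, fun L hL k N _ Y hYP hYQ B hB0 hB c D hD y κ => ?_⟩
  haveI : NeZero (L ^ (k + 1)) := ⟨pow_ne_zero _ (by omega)⟩
  have hD0 : 0 ≤ D := (norm_nonneg _).trans (hD 0)
  have hpow : ((L ^ (k + 1) : ℕ) : ℝ) = (L : ℝ) ^ (k + 1) := by push_cast; ring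
  have hn1 : 1 ≤ L ^ (k + 1) := Nat.one_le_pow _ _ hL
  -- entry by entry
  have hent : ∀ i i', ‖Y y κ i i'‖ ≤ K₀ * ((L : ℝ) ^ (k + 1) * B) + K₀' * ((L : ℝ) ^ (k + 1) * D) := by
    intro i i'
    set ye : Tor (fine (L ^ (k + 1)) (fun _ : Fin (d + 1) => N)) × Fin (d + 1) → ℂ :=
      fun p => Y (rep (fine (L ^ (k + 1)) (fun _ : Fin (d + 1) => N)) p.1) p.2 i i' with hye
    have hQ : QvOp (L ^ (k + 1)) (fun _ : Fin (d + 1) => N) *ᵥ ye = 0 := qvOp_entry_eq_zero_of_QbarIter N hL k hYP hYQ i i'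
    -- the divergence datum on the torus
    set ct : Tor (fun _ : Fin (d + 1) => N) → ℂ := fun s => -((L ^ (k + 1) : ℕ) : ℂ) * c (rep (fun _ : Fin (d + 1) => N) s) i i' with hct
    have hDt : ∀ t, ‖((GradOp (fine (L ^ (k + 1)) (fun _ : Fin (d + 1) => N)) ((L ^ (k + 1) : ℕ) : ℂ))ᴴ *ᵥ ye) t
        - (blkInj (L ^ (k + 1)) (fun _ : Fin (d + 1) => N) *ᵥ ct) t‖ ≤ (L : ℝ) ^ (k + 1) * D := by
      intro t
      rw [hye, divS_entry (L ^ (k + 1)) N hYP i i' t, blkInj_mulVec, hct]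
      dsimp only
      rw [rep_blockOf_eq_blk, ← mul_sub, ← Matrix.sub_apply, norm_mul, norm_neg, Complex.norm_natCast, hpow]
      exact mul_le_mul_of_nonneg_left ((norm_apply_le_norm _ i i').trans (hD _)) (by positivity)
    have hFs : ∀ (μ ν : Fin (d + 1)) (t : Tor (fine (L ^ (k + 1)) (fun _ : Fin (d + 1) => N))),
        ‖Fs (fine (L ^ (k + 1)) (fun _ : Fin (d + 1) => N)) ((L ^ (k + 1) : ℕ) : ℂ) ye μ ν t‖ ≤ (L : ℝ) ^ (k + 1) * B := by
      intro μ ν t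
      have h' := Fs_entry_le (L ^ (k + 1)) N hYP i i' hB0 hB μ ν t
      rw [hpow] at h'
      exact h'
    have key := h (L ^ (k + 1)) N hn1 ye hQ ct _ hDt _ hFs (toT (fine (L ^ (k + 1)) (fun _ : Fin (d + 1) => N)) y, κ)
    have hread : ye (toT (fine (L ^ (k + 1)) (fun _ : Fin (d + 1) => N)) y, κ) = Y y κ i i' := by
      rw [hye]; dsimp only; rw [apply_rep_toT' (P := L ^ (k + 1) * N) hYP y κ]
    rw [← hread]
    exact key
  calc ‖Y y κ‖ ≤ Fintype.card n * (K₀ * ((L : ℝ) ^ (k + 1) * B) + K₀' * ((L : ℝ) ^ (k + 1) * D)) := opNorm_le_card_mul _ hent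
    _ = (L : ℝ) ^ (k + 1) * (Fintype.card n * K₀ * B + Fintype.card n * K₀' * D) := by ring

/-! ## §5 (L) at the flat background, in the shape of `hLet` -/

/-- **THE CURVED SUP LETTER (L) HOLDS AT `W = 1`** (dimension `d + 1 ≥ 2`): `∃ K > 0` (a function of `d`, `card n`) such that for all `L ≥ 1`, `k`, `N ≥ 1`, every
`Y ∈ 𝒯_E(1) = energyBlockLandauW L N (k+1) flatCfg` and every `B` bounding `‖curlAt 1 Y z μ ν‖` off the diagonal: `‖Y y κ‖ ≤ K·L^{k+1}·B` — the hypothesis `hLet` of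
`NE7SliceStepContraction.split_error_sized` at the flat background.  (The flat divergence of `Y` is EXACTLY `L^{k+1}`-block-constant by the local form
`NE7EnergySliceLocalForm.covDiv_eq_nestedExt_of_mem` and `nestedExt_flat`, so §4 applies with `D = 0`.) [folklore] -/
theorem energySlice_sup_flat_site [Nonempty n] (hd : 1 ≤ d) :
    ∃ K : ℝ, 0 < K ∧ ∀ (L : ℕ), 1 ≤ L → ∀ (k N : ℕ) [NeZero N]
      (Y : Site (d + 1) → Fin (d + 1) → Matrix n n ℂ), Y ∈ energyBlockLandauW (d := d + 1) (n := n) L N (k + 1) flatCfg →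
      ∀ (B : ℝ), (∀ (z : Site (d + 1)) (μ ν : Fin (d + 1)), μ ≠ ν → ‖curlAt (flatCfg (d := d + 1) (n := n)) Y z μ ν‖ ≤ B) →
      ∀ (y : Site (d + 1)) (κ : Fin (d + 1)), ‖Y y κ‖ ≤ K * (L : ℝ) ^ (k + 1) * B := by
  obtain ⟨K, hK, K', hK', h⟩ := sup_flat_of_QbarIter (d := d) (n := n)
  refine ⟨K, hK, fun L hL k N _ Y hY B hB y κ => ?_⟩
  haveI : NeZero L := ⟨by omega⟩
  have hμν : (⟨0, by omega⟩ : Fin (d + 1)) ≠ ⟨1, by omega⟩ := by simp [Fin.ext_iff]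
  have hB0 : 0 ≤ B := (norm_nonneg _).trans (hB 0 _ _ hμν)
  have hYP' : IsPeriodicDir Y ((L ^ (k + 1) * N : ℕ) : ℤ) := by rw [← natCast_tower_eq_pow_mul]; exact hY.2.1
  -- the local form at the flat background: the divergence is exactly block-constant
  have hs : LevelSmall (d + 1) L k 0 := levelSmall_of_pow hL k le_rfl (by simp)
  set g := NE3CovariantBlockMean.bmeanIterW L (k + 1) (flatCfg (d := d + 1) (n := n)) (covDiv flatCfg Y) with hg
  have hdiv : ∀ x, ‖flatDiv Y x - g (blk (L ^ (k + 1)) x)‖ ≤ 0 := by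
    intro x
    have hloc := covDiv_eq_nestedExt_of_mem hL k isUnitaryCfg_flatCfg (isPeriodicCfg_flatCfg _) le_rfl hs smallField_flatCfg_zero hY x
    rw [covDiv_flatCfg_eq_flatDiv, nestedExt_flat] at hloc
    rw [hloc, ← hg, sub_self, norm_zero]
  have key := h L hL k N Y hYP' (by rw [← flatCfg_eq_flat]; exact hY.2.2.1) B hB0 (by rw [← flatCfg_eq_flat]; exact hB) g 0 hdiv y κ
  calc ‖Y y κ‖ ≤ (L : ℝ) ^ (k + 1) * (K * B + K' * 0) := key
    _ = K * (L : ℝ) ^ (k + 1) * B := by ring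

end

end Summit.QuantumFields.BalabanUV.T4Continuum.NE7EnergySliceSupFlatSite
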